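import Summits.HodgeConjecture.CorCM.D2Bridge.PinSignatures
import Summits.HodgeConjecture.CorCM.D2Bridge.OmegaAtDeltaPrimeLine
import Summits.HodgeConjecture.CorCM.D2Bridge.OmegaPinAtLiuIndexOfRecord
import Summits.HodgeConjecture.CorCM.B01.Transposition.Item6PinBlockVanishing
import Summits.HodgeConjecture.CorCM.B01.Transposition.Item6CentralTypeAtPinSmooth
import Summits.HodgeConjecture.CorCM.B01.Transposition.Item6UniformOmegaRep
import Summits.HodgeConjecture.HodgeCM.Model.LiuIndexCentralType_1
import Summits.HodgeConjecture.HodgeCM.Model.LiuIndexMuLiu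
import Summits.HodgeConjecture.HodgeCM.Model.LiuDictionaryPinEq
import Summits.HodgeConjecture.HodgeCM.Model.AdelicThetaDistributionSat_1
import Summits.HodgeConjecture.CorCM.Model.CMAbelianVarietyEigenbasisRealisedHolds
import Summits.HodgeConjecture.CorCM.Geometry.BallQuotientUniformisedHolds
import Literature.AlgebraicGeometry.HodgeTheory.ComplexConjugationHolds
import Literature.AlgebraicGeometry.HodgeTheory.HodgeFiltrationModelsReductionProofs
import Literature.NumberTheory.Transcendental.AnalytificationMorphismsProofs
import Literature.NumberTheory.Automorphic.Liu2021.AppendixC.UniformOmegaCiteLegs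
import Literature.NumberTheory.GelbartRogawski1991.UnitaryDualPairThetaKernelCMKTypeFin
import HarnessLib

/-!
# Δ2 bridge — THE BRIDGE THEOREM AT THE LITERAL PIN (`Thm418CAtPin`, assembler DECISIONS #12 ∕ #13)

ONE theorem, kernel lane: `Thm418CAtPin.thm418C_atPin` = ONE application of ✔ `PinSignatures.thm418C_liuDictionaryPin_of_pins` at the
index of record `I := LiuIndex.I V (repAt a₀) (muLiu ι₁ GramClass.rep)`, `line := LiuIndex.line V …`, AT THE RECORD ROWS
`(exists_isReal_hodgeModel_holds, hodgePQ_independent_of_hodgeModel_holds, ballQuotientUniformised_holds, cmAbelianVarietyRealised_of_eigenbasis …,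
arapura2012_cor_15_4_6_holds)`, so that the conclusion is VERBATIM the body of the `h418` binder of ✔ `PortJoin.hc_cm_of_thm418C_local`
(`ClosedLocal.lean`) ∕ `Model.hc_cm_of_port_meeting_rec_local` at `(F, ι₁, V, a₀)`; binder shapes = d2bridge-end-1's §A (E1 = one-token swap).

BY VALUE (group (a), the δ′ re-instantiation — ✔ F4 `OmegaAtDeltaPrime`, own-htheta `Item6UniformOmegaRep`): per index line `i` the μ-UNIFORM
carriers of record `U i := Model.uniformOmegaRep … (2 * imagUnit F)⁻¹ (fun _ _ => r_i)` with the section of record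
`r_i := Rep.update Rep.ofLineOf (locF u_{a_i}) u_{a_i} rfl`, the one-object tails `restTailOne …`, `R₀ := (U i).rest (tail …)`; the cites `hLiu`
[Thm 4.18], `h411R` [Def 4.11], `hD1` [Lem D.1 (1)] are DISPLAYED AT LIU'S OWN REST `Model.restOfCharDeltaPrime … r_i μ hμ hw` (the EXACT object
of the referee's δ′ match) and moved along `Model.restOfCharRep_eq_rest` (`rfl`, paid there); `hnvD` := `nontrivial_omegaAt_restOfCharDeltaPrime_of_lemD1AsPrinted`
(frame transport onto: `isHomeomorph_finPart_cmKTypeHom_finAdelicToAdelic`); `h411 ∕ hsep` of the pin theorem DERIVED (✔ `UniformOmegaCiteLegs`)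
from `h411R`, `hLiu` and the cross-`μ` leg `hμsep` [Lem D.1 (3)]; `Ks := Level.capThree C.S.K₀.1 _` and `hK` by value.
BY VALUE (group (b), the Ω-pin at the index of record — prove-7 `OmegaPinAtLiuIndexOfRecord` over prove-6 `OmegaPinAtDeltaPrime` over F4, keys from
pin-3's X3-Char `Item6CentralTypeAtPinIndex`): the lines' weight-one characters `μ_i` with `Φ_{μ_i} = (line i).lineType` and `σ ∕ hσ ∕ e ∕ he`;
and block vanishing at the non-continuous index lines (pin-3 `Item6CentralTypeAtPinSmooth` + own-htheta `Item6PinBlockVanishing`).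
BY NAME (assembler DECISION #13 §1∕§3 — the residual of record, in `PinSignatures`' abstract currency, for every index line and every weight-one
conjugate-symplectic `μ`): the J-record ∕ pieces families `M ∕ jH ∕ hjHinj ∕ hjH ∕ pieces`, and the cites `h413` [Prop 4.13] at the tower, `hμsep`.
HC_CM is NOT proved by this file; «Δ2 BRIDGE CLOSED» is NOT claimed; `hLiu` is a READING (r8) of [Liu2021, Thm. 4.18] at the constructed objects.

References: Y. Liu, *Fourier–Jacobi cycles and arithmetic relative trace formula*, Camb. J. Math. 9 (2021) = arXiv:2102.11518: Thm. 4.18 (p. 52),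
Prop. 4.13 (p. 47), Def. 4.11 (p. 46), Def. 4.12, Def. 4.5 (2) (p. 42), Lem. 2.4 (1) (p. 23), App. D Lem. D.1 (1),(3) (pp. 125–126).
-/

set_option autoImplicit false

noncomputable section

open scoped TensorProduct Matrix

namespace Summit.HodgeConjecture.CorCM.D2Bridge.Thm418CAtPin

open NumberField NumberField.InfinitePlace IsDedekindDomain
open HodgeCM.Model HodgeCM.Model.LiuIndex HodgeCM.Model.TowerCarrier
open HodgeCM.Literature.Theta.LiuAlbaneseModuleDatum.D2Bridge (HcmPieces)
open Summit.HodgeConjecture.CorCM.Model Summit.HodgeConjecture.CorCM.Transposition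
open Literature.AlgebraicGeometry.Motives (CMType)
open Literature.AlgebraicGeometry.HodgeTheory Literature.NumberTheory.Automorphic.PicardCM
open Literature.AlgebraicGeometry.ShimuraVarieties.UnitaryCanonicalModel
open Literature.NumberTheory.Automorphic
open Literature.NumberTheory.Automorphic.IdeleClassGroup (toHeckeCharacter isUnitary_toHeckeCharacter)
open Literature.NumberTheory.Automorphic.Liu2021 Literature.NumberTheory.Automorphic.Liu2021.AppendixC
open Literature.NumberTheory.Automorphic.Liu2021.AppendixC.RestOne
open Literature.NumberTheory.Automorphic.Liu2021.Def411WeilCarriers (locF Rep)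
open Literature.NumberTheory.GelbartRogawski1991 Literature.NumberTheory.GelbartRogawski1991.UnitaryDualPair
open Literature.NumberTheory.GelbartRogawski1991.UnitaryDualPair.LocalSplitting (localMu norm_localMu continuous_localMu
  localMu_toLocalRing_eq_one_iff)
open Literature.RepresentationTheory Literature.RepresentationTheory.Liu2021
open Summit.HodgeConjecture.CorCM.Transposition.OmegaTransport (realUnit)
open HodgeCM.Model.ArchSideTerm (e₁)

/-! ## The bridge theorem at the literal pin -/

set_option synthInstance.maxHeartbeats 400000 in
set_option maxHeartbeats 6400000 in
/-- **THE BRIDGE THEOREM AT THE LITERAL PIN** (assembler DECISIONS #8–#13).  From the printed citations at the CONSTRUCTED objects — per index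
line `i` and every conjugate-symplectic weight-one `μ`: `hLiu` [Liu21, Thm. 4.18] AS PRINTED at Liu's rest of record at `δ′` (a READING r8),
`h411R` [Def. 4.11] and `hD1` [App. D Lem. D.1 (1)] there, `h413` [Prop. 4.13] AS PRINTED at the tower, `hμsep` (the cross-`μ` leg of
[Lem. D.1 (3)]) — and the residual of record BY NAME: (c) `M ∕ jH ∕ hjHinj ∕ hjH`, (d) `pieces`.  BY VALUE: group (a) (the δ′ re-instantiation:
uniform carriers, tails, rests, `hnvD`, `h411`, `hsep`, `Ks`, `hK`), group (b) (the Ω-pin at the index of record: the lines' weight-one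
characters `μ_i`, `σ ∕ hσ ∕ e ∕ he` — `OmegaPin.exists_pinTerms_indexOfRecord`) and block vanishing off the continuous lines
(`block_pin_lineOf_eq_bot_of_not_smooth` + `continuous_of_hasCentralTypeAt_of_smooth`).  Conclusion = the
reading r8 `Thm418C` of the pinned dictionary of record at `(F, ι₁, V, a₀)`, VERBATIM the `h418` binder body of `PortJoin.hc_cm_of_thm418C_local`.
CAVEAT OF RECORD (coordinator, ORIENTATION-MEMO v1.3 §0 4): «the by-name family {M, jH, hjHinj, hjH, pieces} is jointly inhabitable only if
every PhiMu block vanishes — orientation inconsistency between Stage-1's dictionary keyed at ι₁ and the PATH A pin along ῑ₁, under adjudication».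
HC_CM is NOT proved here; NOT «Δ2 BRIDGE CLOSED».
[cite: Liu2021, Thm. 4.18 (FJcycle.tex l. 2232–2245); Prop. 4.13 (l. 2113–2119); Def. 4.11 (l. 2083–2097); App. D Lem. D.1 (1),(3) (l. 5226–5233)] -/
theorem thm418C_atPin (F : HodgeCM.CMField) [IsGalois ℚ (F : Type)] (h6 : 6 ≤ Module.finrank ℚ (F : Type))
    {ι₁ : (F : Type) →+* ℂ} (V : HodgeCM.HermSpace3 F ι₁) (hV : (InfinitePlace.mk ι₁).embedding = ι₁) (a₀ : RealScalar F)
    (h : exists_recordSystem) (Φ : CMType (F : Type))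
    -- [Liu2021, Thm. 4.18] AS PRINTED at Liu's rests of record at δ′ — a READING r8 at the constructed objects
    (hLiu : ∀ (i : (I V (repAt a₀) (muLiu ι₁ GramClass.rep))) (μ : Literature.NumberTheory.Automorphic.IdeleClassGroup (F : Type) →ₜ* Circle)
      (hμ : IdeleClassGroup.IsConjugateSymplectic (F : Type) μ) (hw : IdeleClassGroup.HasWeight (F : Type) μ 1),
      Thm418AsPrinted (toThm418Data _ (restOfCharDeltaPrimeLine h ⟨F.K⟩ h6 ι₁ (⟨V.Hm, V.isHermitian, V.signature_ι₁, V.posDef_of_ne⟩) Φ e₁ (frameD V) (frameD_real V) (frameD_ne V) (ιVE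
            V) (repAt a₀ (Sigma.fst i)).1 (repAt a₀ (Sigma.fst i)).2.1 (repAt a₀ (Sigma.fst i)).2.2 μ hμ hw)))
    -- [Liu2021, Def. 4.11] AS PRINTED at those rests
    (h411R : ∀ (i : (I V (repAt a₀) (muLiu ι₁ GramClass.rep))) (μ : Literature.NumberTheory.Automorphic.IdeleClassGroup (F : Type) →ₜ* Circle)
      (hμ : IdeleClassGroup.IsConjugateSymplectic (F : Type) μ) (hw : IdeleClassGroup.HasWeight (F : Type) μ 1),
      Def411AsPrinted (toThm418Data _ (restOfCharDeltaPrimeLine h ⟨F.K⟩ h6 ι₁ (⟨V.Hm, V.isHermitian, V.signature_ι₁, V.posDef_of_ne⟩) Φ e₁ (frameD V) (frameD_real V) (frameD_ne V) (ιVE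
            V) (repAt a₀ (Sigma.fst i)).1 (repAt a₀ (Sigma.fst i)).2.1 (repAt a₀ (Sigma.fst i)).2.2 μ hμ hw)))
    -- [Liu2021, App. D Lem. D.1 (1)] AS PRINTED at every finite place of the local data of those rests
    (hD1 : ∀ (i : (I V (repAt a₀) (muLiu ι₁ GramClass.rep))) (μ : Literature.NumberTheory.Automorphic.IdeleClassGroup (F : Type) →ₜ* Circle)
      (hμ : IdeleClassGroup.IsConjugateSymplectic (F : Type) μ) (hw : IdeleClassGroup.HasWeight (F : Type) μ 1)
      (j : (toThm418Data _ (restOfCharDeltaPrimeLine h ⟨F.K⟩ h6 ι₁ (⟨V.Hm, V.isHermitian, V.signature_ι₁, V.posDef_of_ne⟩) Φ e₁ (frameD V) (frameD_real V) (frameD_ne V) (ιVE V) (repAt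
            a₀ (Sigma.fst i)).1 (repAt a₀ (Sigma.fst i)).2.1 (repAt a₀ (Sigma.fst i)).2.2 μ hμ hw)).AdmIndex) (v : HeightOneSpectrum (𝓞 ↥(maximalRealSubfield (F : Type)))),
      LemD1_1AsPrinted
      (Def411WeilCarriers.localLemD1Data ↥(maximalRealSubfield (F : Type)) (F : Type) (IsCMField.complexConj (F : Type)) 3 e₁
        (Matrix.diagonal (frameD V)) (complexConj_imagUnit (F : Type)) (imagUnit_ne_zero (F : Type)) (imagUnit_mul_self (F : Type))
        (realDiagonal_isSymm (F : Type) (frameD V) (frameD_real V)) (isUnit_det_realDiagonal (F : Type) (frameD V) (frameD_real V) (frameD_ne V))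
        (realDiagonal_map (F : Type) (frameD V) (frameD_real V)).symm (((repOfLine ⟨F.K⟩ (repAt a₀ (Sigma.fst i)).1 (repAt a₀ (Sigma.fst i)).2.1 (repAt a₀ (Sigma.fst i)).2.2)).toFun
              j.1.1)
        (OmegaChiSplitting.chiLocalSplittingsD ⟨F.K⟩ e₁ (frameD V) (frameD_real V) (frameD_ne V) (toHeckeCharacter (F : Type) μ)
          ((isOscillatorChar_toHeckeCharacter_iff μ).mpr hμ) (((repOfLine ⟨F.K⟩ (repAt a₀ (Sigma.fst i)).1 (repAt a₀ (Sigma.fst i)).2.1 (repAt a₀ (Sigma.fst i)).2.2)).toFun j.1.1))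
        (le_refl 3) (localMu (F : Type) (toHeckeCharacter (F : Type) μ))
        (fun v x => norm_localMu (F : Type) (toHeckeCharacter (F : Type) μ) v (isUnitary_toHeckeCharacter (F : Type) μ) x)
        (continuous_localMu (F : Type) (toHeckeCharacter (F : Type) μ))
        (fun v t => localMu_toLocalRing_eq_one_iff (F : Type) (toHeckeCharacter (F : Type) μ) v ((isOscillatorChar_toHeckeCharacter_iff μ).mpr hμ) t)
        j.1.2.1
        (Def411WeilCarriers.norm_chi_eq_one ↥(maximalRealSubfield (F : Type)) (F : Type) (IsCMField.complexConj (F : Type))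
          (Algebra.IsQuadraticExtension.finrank_eq_two ↥(maximalRealSubfield (F : Type)) (F : Type))
          (UnitaryGroup.algEquiv_ne_one_of_apply_eq_neg ↥(maximalRealSubfield (F : Type)) (F : Type) (IsCMField.complexConj (F : Type))
            (complexConj_imagUnit (F : Type)) (imagUnit_ne_zero (F : Type))) j.1.2)
        j.1.2.2.1 v))
    -- [Liu2021, Prop. 4.13] AS PRINTED over the uniform carriers of record, `H¹_{B,ι₁}(A_∞, ℂ)` read as the tower
    (h413 : ∀ i : (I V (repAt a₀) (muLiu ι₁ GramClass.rep)), Prop413AsPrinted (((uniformOmegaRep h ⟨F.K⟩ ι₁ (⟨V.Hm, V.isHermitian, V.signature_ι₁, V.posDef_of_ne⟩) Φ e₁ (frameD V)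
          (frameD_real V) (frameD_ne V) (ιVE V) (2 * imagUnit (HodgeCM.CMField.K F))⁻¹ (fun _ _ => (repOfLine ⟨F.K⟩ (repAt a₀ (Sigma.fst i)).1 (repAt a₀ (Sigma.fst i)).2.1 (repAt a₀
          (Sigma.fst i)).2.2)))).prop413Data ((liuDictionaryPin exists_isReal_hodgeModel_holds hodgePQ_independent_of_hodgeModel_holds BallQuotient.ballQuotientUniformised_holds
          (cmAbelianVarietyRealised_of_eigenbasis exists_isReal_hodgeModel_holds hodgePQ_independent_of_hodgeModel_holds cmAbelianVarietyEigenbasisRealised_holds)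
          Literature.NumberTheory.Transcendental.arapura2012_cor_15_4_6_holds V (I V (repAt a₀) (muLiu ι₁ GramClass.rep)) (line V (repAt a₀) (muLiu ι₁ GramClass.rep)))).H))
    -- the cross-`μ` separation leg ([Liu2021, App. D Lem. D.1 (3)] with «μ = ⊗_v μ_v»)
    (hμsep : ∀ (i : (I V (repAt a₀) (muLiu ι₁ GramClass.rep))) (s t : (((uniformOmegaRep h ⟨F.K⟩ ι₁ (⟨V.Hm, V.isHermitian, V.signature_ι₁, V.posDef_of_ne⟩) Φ e₁ (frameD V) (frameD_real
          V) (frameD_ne V) (ιVE V) (2 * imagUnit (HodgeCM.CMField.K F))⁻¹ (fun _ _ => (repOfLine ⟨F.K⟩ (repAt a₀ (Sigma.fst i)).1 (repAt a₀ (Sigma.fst i)).2.1 (repAt a₀ (Sigma.fst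
          i)).2.2)))).prop413Data ((liuDictionaryPin exists_isReal_hodgeModel_holds hodgePQ_independent_of_hodgeModel_holds BallQuotient.ballQuotientUniformised_holds
          (cmAbelianVarietyRealised_of_eigenbasis exists_isReal_hodgeModel_holds hodgePQ_independent_of_hodgeModel_holds cmAbelianVarietyEigenbasisRealised_holds)
          Literature.NumberTheory.Transcendental.arapura2012_cor_15_4_6_holds V (I V (repAt a₀) (muLiu ι₁ GramClass.rep)) (line V (repAt a₀) (muLiu ι₁ GramClass.rep)))).H).AdmTriple),
      Nontrivial ((((uniformOmegaRep h ⟨F.K⟩ ι₁ (⟨V.Hm, V.isHermitian, V.signature_ι₁, V.posDef_of_ne⟩) Φ e₁ (frameD V) (frameD_real V) (frameD_ne V) (ιVE V) (2 * imagUnit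
            (HodgeCM.CMField.K F))⁻¹ (fun _ _ => (repOfLine ⟨F.K⟩ (repAt a₀ (Sigma.fst i)).1 (repAt a₀ (Sigma.fst i)).2.1 (repAt a₀ (Sigma.fst i)).2.2)))).prop413Data
            ((liuDictionaryPin exists_isReal_hodgeModel_holds hodgePQ_independent_of_hodgeModel_holds BallQuotient.ballQuotientUniformised_holds (cmAbelianVarietyRealised_of_eigenbasis
            exists_isReal_hodgeModel_holds hodgePQ_independent_of_hodgeModel_holds cmAbelianVarietyEigenbasisRealised_holds)
            Literature.NumberTheory.Transcendental.arapura2012_cor_15_4_6_holds V (I V (repAt a₀) (muLiu ι₁ GramClass.rep)) (line V (repAt a₀) (muLiu ι₁ GramClass.rep)))).H).omegaAt s)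
            →
      (∃ f : (((uniformOmegaRep h ⟨F.K⟩ ι₁ (⟨V.Hm, V.isHermitian, V.signature_ι₁, V.posDef_of_ne⟩) Φ e₁ (frameD V) (frameD_real V) (frameD_ne V) (ιVE V) (2 * imagUnit
            (HodgeCM.CMField.K F))⁻¹ (fun _ _ => (repOfLine ⟨F.K⟩ (repAt a₀ (Sigma.fst i)).1 (repAt a₀ (Sigma.fst i)).2.1 (repAt a₀ (Sigma.fst i)).2.2)))).prop413Data
            ((liuDictionaryPin exists_isReal_hodgeModel_holds hodgePQ_independent_of_hodgeModel_holds BallQuotient.ballQuotientUniformised_holds (cmAbelianVarietyRealised_of_eigenbasis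
            exists_isReal_hodgeModel_holds hodgePQ_independent_of_hodgeModel_holds cmAbelianVarietyEigenbasisRealised_holds)
            Literature.NumberTheory.Transcendental.arapura2012_cor_15_4_6_holds V (I V (repAt a₀) (muLiu ι₁ GramClass.rep)) (line V (repAt a₀) (muLiu ι₁ GramClass.rep)))).H).omegaAt s
            ≃ₗ[ℂ]
          (((uniformOmegaRep h ⟨F.K⟩ ι₁ (⟨V.Hm, V.isHermitian, V.signature_ι₁, V.posDef_of_ne⟩) Φ e₁ (frameD V) (frameD_real V) (frameD_ne V) (ιVE V) (2 * imagUnit (HodgeCM.CMField.K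
                F))⁻¹ (fun _ _ => (repOfLine ⟨F.K⟩ (repAt a₀ (Sigma.fst i)).1 (repAt a₀ (Sigma.fst i)).2.1 (repAt a₀ (Sigma.fst i)).2.2)))).prop413Data ((liuDictionaryPin
                exists_isReal_hodgeModel_holds hodgePQ_independent_of_hodgeModel_holds BallQuotient.ballQuotientUniformised_holds (cmAbelianVarietyRealised_of_eigenbasis
                exists_isReal_hodgeModel_holds hodgePQ_independent_of_hodgeModel_holds cmAbelianVarietyEigenbasisRealised_holds)
                Literature.NumberTheory.Transcendental.arapura2012_cor_15_4_6_holds V (I V (repAt a₀) (muLiu ι₁ GramClass.rep)) (line V (repAt a₀) (muLiu ι₁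
                GramClass.rep)))).H).omegaAt t,
        ∀ (g : ↥V.adelicFin) (v : (((uniformOmegaRep h ⟨F.K⟩ ι₁ (⟨V.Hm, V.isHermitian, V.signature_ι₁, V.posDef_of_ne⟩) Φ e₁ (frameD V) (frameD_real V) (frameD_ne V) (ιVE V) (2 *
              imagUnit (HodgeCM.CMField.K F))⁻¹ (fun _ _ => (repOfLine ⟨F.K⟩ (repAt a₀ (Sigma.fst i)).1 (repAt a₀ (Sigma.fst i)).2.1 (repAt a₀ (Sigma.fst i)).2.2)))).prop413Data
              ((liuDictionaryPin exists_isReal_hodgeModel_holds hodgePQ_independent_of_hodgeModel_holds BallQuotient.ballQuotientUniformised_holds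
              (cmAbelianVarietyRealised_of_eigenbasis exists_isReal_hodgeModel_holds hodgePQ_independent_of_hodgeModel_holds cmAbelianVarietyEigenbasisRealised_holds)
              Literature.NumberTheory.Transcendental.arapura2012_cor_15_4_6_holds V (I V (repAt a₀) (muLiu ι₁ GramClass.rep)) (line V (repAt a₀) (muLiu ι₁ GramClass.rep)))).H).omegaAt
              s),
          f ((((uniformOmegaRep h ⟨F.K⟩ ι₁ (⟨V.Hm, V.isHermitian, V.signature_ι₁, V.posDef_of_ne⟩) Φ e₁ (frameD V) (frameD_real V) (frameD_ne V) (ιVE V) (2 * imagUnit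
                (HodgeCM.CMField.K F))⁻¹ (fun _ _ => (repOfLine ⟨F.K⟩ (repAt a₀ (Sigma.fst i)).1 (repAt a₀ (Sigma.fst i)).2.1 (repAt a₀ (Sigma.fst i)).2.2)))).prop413Data
                ((liuDictionaryPin exists_isReal_hodgeModel_holds hodgePQ_independent_of_hodgeModel_holds BallQuotient.ballQuotientUniformised_holds
                (cmAbelianVarietyRealised_of_eigenbasis exists_isReal_hodgeModel_holds hodgePQ_independent_of_hodgeModel_holds cmAbelianVarietyEigenbasisRealised_holds)
                Literature.NumberTheory.Transcendental.arapura2012_cor_15_4_6_holds V (I V (repAt a₀) (muLiu ι₁ GramClass.rep)) (line V (repAt a₀) (muLiu ι₁ GramClass.rep)))).H).rhoAt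
                s g v) =
            (((uniformOmegaRep h ⟨F.K⟩ ι₁ (⟨V.Hm, V.isHermitian, V.signature_ι₁, V.posDef_of_ne⟩) Φ e₁ (frameD V) (frameD_real V) (frameD_ne V) (ιVE V) (2 * imagUnit (HodgeCM.CMField.K
                  F))⁻¹ (fun _ _ => (repOfLine ⟨F.K⟩ (repAt a₀ (Sigma.fst i)).1 (repAt a₀ (Sigma.fst i)).2.1 (repAt a₀ (Sigma.fst i)).2.2)))).prop413Data ((liuDictionaryPin
                  exists_isReal_hodgeModel_holds hodgePQ_independent_of_hodgeModel_holds BallQuotient.ballQuotientUniformised_holds (cmAbelianVarietyRealised_of_eigenbasis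
                  exists_isReal_hodgeModel_holds hodgePQ_independent_of_hodgeModel_holds cmAbelianVarietyEigenbasisRealised_holds)
                  Literature.NumberTheory.Transcendental.arapura2012_cor_15_4_6_holds V (I V (repAt a₀) (muLiu ι₁ GramClass.rep)) (line V (repAt a₀) (muLiu ι₁
                  GramClass.rep)))).H).rhoAt t g (f v)) →
      s.1.μ = t.1.μ)
    -- THE Δ2 RESIDUAL OF RECORD (assembler DECISION #13 §1): (c) the J-record pin and (d) the pieces, in `PinSignatures`' currency
    (M : ∀ (i : (I V (repAt a₀) (muLiu ι₁ GramClass.rep))) (μ : Literature.NumberTheory.Automorphic.IdeleClassGroup (F : Type) →ₜ* Circle)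
      (hμ : IdeleClassGroup.IsConjugateSymplectic (F : Type) μ) (hw : IdeleClassGroup.HasWeight (F : Type) μ 1),
      (toThm418Data _ (((uniformOmegaRep h ⟨F.K⟩ ι₁ (⟨V.Hm, V.isHermitian, V.signature_ι₁, V.posDef_of_ne⟩) Φ e₁ (frameD V) (frameD_real V) (frameD_ne V) (ιVE V) (2 * imagUnit
            (HodgeCM.CMField.K F))⁻¹ (fun _ _ => (repOfLine ⟨F.K⟩ (repAt a₀ (Sigma.fst i)).1 (repAt a₀ (Sigma.fst i)).2.1 (repAt a₀ (Sigma.fst i)).2.2)))).rest (restTailOne (AlgHom.id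
            ℚ _) ι₁ hμ hw (Def45.Carriers.ofPolDR μ (Def45.PolDR ι₁ hμ (Def45.RMuForm ι₁ hμ))) ((heckeTranslatesFamilyOf heckeTranslate_definedOver_holds h isoOf ⟨F.K⟩ ι₁ (⟨V.Hm,
            V.isHermitian, V.signature_ι₁, V.posDef_of_ne⟩) Φ h6).rhoΩOne (AlgHom.id ℚ _) ι₁ hμ hw (Def45.Carriers.ofPolDR μ (Def45.PolDR ι₁ hμ (Def45.RMuForm ι₁
            hμ))))))).Map43RationalData)
    (jH : ∀ (i : (I V (repAt a₀) (muLiu ι₁ GramClass.rep))) (μ : Literature.NumberTheory.Automorphic.IdeleClassGroup (F : Type) →ₜ* Circle)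
      (hμ : IdeleClassGroup.IsConjugateSymplectic (F : Type) μ) (hw : IdeleClassGroup.HasWeight (F : Type) μ 1),
      (M i μ hμ hw).HB →ₗ[ℂ] ((liuDictionaryPin exists_isReal_hodgeModel_holds hodgePQ_independent_of_hodgeModel_holds BallQuotient.ballQuotientUniformised_holds
            (cmAbelianVarietyRealised_of_eigenbasis exists_isReal_hodgeModel_holds hodgePQ_independent_of_hodgeModel_holds cmAbelianVarietyEigenbasisRealised_holds)
            Literature.NumberTheory.Transcendental.arapura2012_cor_15_4_6_holds V (I V (repAt a₀) (muLiu ι₁ GramClass.rep)) (line V (repAt a₀) (muLiu ι₁ GramClass.rep)))).H)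
    (hjHinj : ∀ (i : (I V (repAt a₀) (muLiu ι₁ GramClass.rep))) (μ : Literature.NumberTheory.Automorphic.IdeleClassGroup (F : Type) →ₜ* Circle)
      (hμ : IdeleClassGroup.IsConjugateSymplectic (F : Type) μ) (hw : IdeleClassGroup.HasWeight (F : Type) μ 1), Function.Injective (jH i μ hμ hw))
    (hjH : ∀ (i : (I V (repAt a₀) (muLiu ι₁ GramClass.rep))) (μ : Literature.NumberTheory.Automorphic.IdeleClassGroup (F : Type) →ₜ* Circle)
      (hμ : IdeleClassGroup.IsConjugateSymplectic (F : Type) μ) (hw : IdeleClassGroup.HasWeight (F : Type) μ 1) (g : ↥V.adelicFin)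
      (x : (M i μ hμ hw).HB), jH i μ hμ hw ((M i μ hμ hw).ρB g x) = MonoidAlgebra.of ℂ ↥V.adelicFin g • jH i μ hμ hw x)
    (pieces : ∀ (i : (I V (repAt a₀) (muLiu ι₁ GramClass.rep))) (μ : Literature.NumberTheory.Automorphic.IdeleClassGroup (F : Type) →ₜ* Circle)
      (hμ : IdeleClassGroup.IsConjugateSymplectic (F : Type) μ) (hw : IdeleClassGroup.HasWeight (F : Type) μ 1) (K : HodgeCM.Level V),
      K ≤ (HodgeCM.Level.capThree (V := V) (((sec42DataOf h isoOf ⟨F.K⟩ ι₁ (⟨V.Hm, V.isHermitian, V.signature_ι₁, V.posDef_of_ne⟩) Φ)).S.K₀.1 : Subgroup ↥(HodgeCM.HermSpace3.adelicFin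
            V)) ((sec42DataOf h isoOf ⟨F.K⟩ ι₁ (⟨V.Hm, V.isHermitian, V.signature_ι₁, V.posDef_of_ne⟩) Φ)).S.K₀.2.1) →
      HcmPieces.{0, 1, 0} (toThm418Data _ (((uniformOmegaRep h ⟨F.K⟩ ι₁ (⟨V.Hm, V.isHermitian, V.signature_ι₁, V.posDef_of_ne⟩) Φ e₁ (frameD V) (frameD_real V) (frameD_ne V) (ιVE V) (2
            * imagUnit (HodgeCM.CMField.K F))⁻¹ (fun _ _ => (repOfLine ⟨F.K⟩ (repAt a₀ (Sigma.fst i)).1 (repAt a₀ (Sigma.fst i)).2.1 (repAt a₀ (Sigma.fst i)).2.2)))).rest (restTailOne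
            (AlgHom.id ℚ _) ι₁ hμ hw (Def45.Carriers.ofPolDR μ (Def45.PolDR ι₁ hμ (Def45.RMuForm ι₁ hμ))) ((heckeTranslatesFamilyOf heckeTranslate_definedOver_holds h isoOf ⟨F.K⟩ ι₁
            (⟨V.Hm, V.isHermitian, V.signature_ι₁, V.posDef_of_ne⟩) Φ h6).rhoΩOne (AlgHom.id ℚ _) ι₁ hμ hw (Def45.Carriers.ofPolDR μ (Def45.PolDR ι₁ hμ (Def45.RMuForm ι₁ hμ))))))) (M i
            μ hμ hw) ((liuDictionaryPin exists_isReal_hodgeModel_holds hodgePQ_independent_of_hodgeModel_holds BallQuotient.ballQuotientUniformised_holds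
            (cmAbelianVarietyRealised_of_eigenbasis exists_isReal_hodgeModel_holds hodgePQ_independent_of_hodgeModel_holds cmAbelianVarietyEigenbasisRealised_holds)
            Literature.NumberTheory.Transcendental.arapura2012_cor_15_4_6_holds V (I V (repAt a₀) (muLiu ι₁ GramClass.rep)) (line V (repAt a₀) (muLiu ι₁ GramClass.rep)))).H
        (jH i μ hμ hw) K.K
        ((HodgeCM.Model.picardCMUniverse exists_isReal_hodgeModel_holds hodgePQ_independent_of_hodgeModel_holds
            BallQuotient.ballQuotientUniformised_holds
            (cmAbelianVarietyRealised_of_eigenbasis exists_isReal_hodgeModel_holds hodgePQ_independent_of_hodgeModel_holds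
              cmAbelianVarietyEigenbasisRealised_holds)).CohC
          ((HodgeCM.Model.picardCMUniverse exists_isReal_hodgeModel_holds hodgePQ_independent_of_hodgeModel_holds
            BallQuotient.ballQuotientUniformised_holds
            (cmAbelianVarietyRealised_of_eigenbasis exists_isReal_hodgeModel_holds hodgePQ_independent_of_hodgeModel_holds
              cmAbelianVarietyEigenbasisRealised_holds)).pms F ι₁ V K) 1)
        (resTotal exists_isReal_hodgeModel_holds hodgePQ_independent_of_hodgeModel_holds
          (ballQuotientUniformisedDatum_of BallQuotient.ballQuotientUniformised_holds)
          (cmAbelianVarietyRealised_of_eigenbasis exists_isReal_hodgeModel_holds hodgePQ_independent_of_hodgeModel_holds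
            cmAbelianVarietyEigenbasisRealised_holds)
          Literature.NumberTheory.Transcendental.arapura2012_cor_15_4_6_holds K)
        (((liuDictionaryPin exists_isReal_hodgeModel_holds hodgePQ_independent_of_hodgeModel_holds BallQuotient.ballQuotientUniformised_holds (cmAbelianVarietyRealised_of_eigenbasis
              exists_isReal_hodgeModel_holds hodgePQ_independent_of_hodgeModel_holds cmAbelianVarietyEigenbasisRealised_holds)
              Literature.NumberTheory.Transcendental.arapura2012_cor_15_4_6_holds V (I V (repAt a₀) (muLiu ι₁ GramClass.rep)) (line V (repAt a₀) (muLiu ι₁ GramClass.rep)))).cmClasses K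
              i)) :
    ((liuDictionaryPin exists_isReal_hodgeModel_holds hodgePQ_independent_of_hodgeModel_holds BallQuotient.ballQuotientUniformised_holds (cmAbelianVarietyRealised_of_eigenbasis
          exists_isReal_hodgeModel_holds hodgePQ_independent_of_hodgeModel_holds cmAbelianVarietyEigenbasisRealised_holds)
          Literature.NumberTheory.Transcendental.arapura2012_cor_15_4_6_holds V (I V (repAt a₀) (muLiu ι₁ GramClass.rep)) (line V (repAt a₀) (muLiu ι₁ GramClass.rep)))).Thm418C := by
  -- the `(R, hR)` seam: Liu's rest of record at `δ′` IS the uniform rest (own-htheta `restOfCharRep_eq_rest`, `rfl` — paid once, there)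
  have hR : ∀ (i : (I V (repAt a₀) (muLiu ι₁ GramClass.rep))) (μ : Literature.NumberTheory.Automorphic.IdeleClassGroup (F : Type) →ₜ* Circle)
      (hμ : IdeleClassGroup.IsConjugateSymplectic (F : Type) μ) (hw : IdeleClassGroup.HasWeight (F : Type) μ 1),
      (restOfCharDeltaPrimeLine h ⟨F.K⟩ h6 ι₁ (⟨V.Hm, V.isHermitian, V.signature_ι₁, V.posDef_of_ne⟩) Φ e₁ (frameD V) (frameD_real V) (frameD_ne V) (ιVE V) (repAt a₀ (Sigma.fst i)).1
            (repAt a₀ (Sigma.fst i)).2.1 (repAt a₀ (Sigma.fst i)).2.2 μ hμ hw) = ((uniformOmegaRep h ⟨F.K⟩ ι₁ (⟨V.Hm, V.isHermitian, V.signature_ι₁, V.posDef_of_ne⟩) Φ e₁ (frameD V)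
            (frameD_real V) (frameD_ne V) (ιVE V) (2 * imagUnit (HodgeCM.CMField.K F))⁻¹ (fun _ _ => (repOfLine ⟨F.K⟩ (repAt a₀ (Sigma.fst i)).1 (repAt a₀ (Sigma.fst i)).2.1 (repAt a₀
            (Sigma.fst i)).2.2)))).rest (restTailOne (AlgHom.id ℚ _) ι₁ hμ hw (Def45.Carriers.ofPolDR μ (Def45.PolDR ι₁ hμ (Def45.RMuForm ι₁ hμ))) ((heckeTranslatesFamilyOf
            heckeTranslate_definedOver_holds h isoOf ⟨F.K⟩ ι₁ (⟨V.Hm, V.isHermitian, V.signature_ι₁, V.posDef_of_ne⟩) Φ h6).rhoΩOne (AlgHom.id ℚ _) ι₁ hμ hw (Def45.Carriers.ofPolDR μ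
            (Def45.PolDR ι₁ hμ (Def45.RMuForm ι₁ hμ))))) := fun i μ hμ hw =>
    restOfCharRep_eq_rest h ⟨F.K⟩ ι₁ (⟨V.Hm, V.isHermitian, V.signature_ι₁, V.posDef_of_ne⟩) Φ e₁ (frameD V) (frameD_real V) (frameD_ne V) (ιVE V) (2 * imagUnit (F : Type))⁻¹
      (fun _ _ => (repOfLine ⟨F.K⟩ (repAt a₀ (Sigma.fst i)).1 (repAt a₀ (Sigma.fst i)).2.1 (repAt a₀ (Sigma.fst i)).2.2)) h6 μ hμ hw
  -- (b) THE Ω-PIN AT THE INDEX OF RECORD, BY VALUE (prove-7 `OmegaPin.exists_pinTerms_indexOfRecord` over prove-6's `Model.exists_omegaPin_line`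
  --     over ✔ F4; keys from pin-3's X3-Char `Item6CentralTypeAtPinIndex`): the lines' weight-one characters `μ_i` and `σ ∕ e` with `hσ ∕ he`
  obtain ⟨μ, hμ, hw, σ, e, -, hσ, he⟩ :=
    HodgeCM.Model.LiuIndex.OmegaPin.exists_pinTerms_indexOfRecord V a₀ (ιVE V) h h6 Φ hV
      (fun i _ _ μ hμ hw => ((uniformOmegaRep h ⟨F.K⟩ ι₁ (⟨V.Hm, V.isHermitian, V.signature_ι₁, V.posDef_of_ne⟩) Φ e₁ (frameD V) (frameD_real V) (frameD_ne V) (ιVE V) (2 * imagUnit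
            (HodgeCM.CMField.K F))⁻¹ (fun _ _ => (repOfLine ⟨F.K⟩ (repAt a₀ (Sigma.fst i)).1 (repAt a₀ (Sigma.fst i)).2.1 (repAt a₀ (Sigma.fst i)).2.2)))).rest (restTailOne (AlgHom.id
            ℚ _) ι₁ hμ hw (Def45.Carriers.ofPolDR μ (Def45.PolDR ι₁ hμ (Def45.RMuForm ι₁ hμ))) ((heckeTranslatesFamilyOf heckeTranslate_definedOver_holds h isoOf ⟨F.K⟩ ι₁ (⟨V.Hm,
            V.isHermitian, V.signature_ι₁, V.posDef_of_ne⟩) Φ h6).rhoΩOne (AlgHom.id ℚ _) ι₁ hμ hw (Def45.Carriers.ofPolDR μ (Def45.PolDR ι₁ hμ (Def45.RMuForm ι₁ hμ)))))) (fun i _ _ μ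
            hμ hw => hR i μ hμ hw)
  -- [Thm 4.18] and [Def 4.11] moved along the seam
  have hLiu' : ∀ (i : (I V (repAt a₀) (muLiu ι₁ GramClass.rep))) (μ : Literature.NumberTheory.Automorphic.IdeleClassGroup (F : Type) →ₜ* Circle)
      (hμ : IdeleClassGroup.IsConjugateSymplectic (F : Type) μ) (hw : IdeleClassGroup.HasWeight (F : Type) μ 1),
      Thm418AsPrinted (toThm418Data _ (((uniformOmegaRep h ⟨F.K⟩ ι₁ (⟨V.Hm, V.isHermitian, V.signature_ι₁, V.posDef_of_ne⟩) Φ e₁ (frameD V) (frameD_real V) (frameD_ne V) (ιVE V) (2 *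
            imagUnit (HodgeCM.CMField.K F))⁻¹ (fun _ _ => (repOfLine ⟨F.K⟩ (repAt a₀ (Sigma.fst i)).1 (repAt a₀ (Sigma.fst i)).2.1 (repAt a₀ (Sigma.fst i)).2.2)))).rest (restTailOne
            (AlgHom.id ℚ _) ι₁ hμ hw (Def45.Carriers.ofPolDR μ (Def45.PolDR ι₁ hμ (Def45.RMuForm ι₁ hμ))) ((heckeTranslatesFamilyOf heckeTranslate_definedOver_holds h isoOf ⟨F.K⟩ ι₁
            (⟨V.Hm, V.isHermitian, V.signature_ι₁, V.posDef_of_ne⟩) Φ h6).rhoΩOne (AlgHom.id ℚ _) ι₁ hμ hw (Def45.Carriers.ofPolDR μ (Def45.PolDR ι₁ hμ (Def45.RMuForm ι₁ hμ))))))) :=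
            fun i μ hμ hw => by
    rw [← hR]; exact hLiu i μ hμ hw
  have h411' : ∀ (i : (I V (repAt a₀) (muLiu ι₁ GramClass.rep))) (μ : Literature.NumberTheory.Automorphic.IdeleClassGroup (F : Type) →ₜ* Circle)
      (hμ : IdeleClassGroup.IsConjugateSymplectic (F : Type) μ) (hw : IdeleClassGroup.HasWeight (F : Type) μ 1),
      Def411AsPrinted (toThm418Data _ (((uniformOmegaRep h ⟨F.K⟩ ι₁ (⟨V.Hm, V.isHermitian, V.signature_ι₁, V.posDef_of_ne⟩) Φ e₁ (frameD V) (frameD_real V) (frameD_ne V) (ιVE V) (2 *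
            imagUnit (HodgeCM.CMField.K F))⁻¹ (fun _ _ => (repOfLine ⟨F.K⟩ (repAt a₀ (Sigma.fst i)).1 (repAt a₀ (Sigma.fst i)).2.1 (repAt a₀ (Sigma.fst i)).2.2)))).rest (restTailOne
            (AlgHom.id ℚ _) ι₁ hμ hw (Def45.Carriers.ofPolDR μ (Def45.PolDR ι₁ hμ (Def45.RMuForm ι₁ hμ))) ((heckeTranslatesFamilyOf heckeTranslate_definedOver_holds h isoOf ⟨F.K⟩ ι₁
            (⟨V.Hm, V.isHermitian, V.signature_ι₁, V.posDef_of_ne⟩) Φ h6).rhoΩOne (AlgHom.id ℚ _) ι₁ hμ hw (Def45.Carriers.ofPolDR μ (Def45.PolDR ι₁ hμ (Def45.RMuForm ι₁ hμ))))))) :=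
            fun i μ hμ hw => by
    rw [← hR]; exact h411R i μ hμ hw
  -- [Lem D.1 (1)] ⟹ `ω ≠ 0` at the rests (✔ F4; the frame transport of record is onto: it is a homeomorphism)
  have hιs : Function.Surjective (ιVE V) :=
    (isHomeomorph_finPart_cmKTypeHom_finAdelicToAdelic (F : Type) V.Hm (frameG V) (frameD V) (frame_congr V)).surjective
  have hnvD : ∀ (i : (I V (repAt a₀) (muLiu ι₁ GramClass.rep))) (μ : Literature.NumberTheory.Automorphic.IdeleClassGroup (F : Type) →ₜ* Circle)
      (hμ : IdeleClassGroup.IsConjugateSymplectic (F : Type) μ) (hw : IdeleClassGroup.HasWeight (F : Type) μ 1)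
      (j : (toThm418Data _ (((uniformOmegaRep h ⟨F.K⟩ ι₁ (⟨V.Hm, V.isHermitian, V.signature_ι₁, V.posDef_of_ne⟩) Φ e₁ (frameD V) (frameD_real V) (frameD_ne V) (ιVE V) (2 * imagUnit
            (HodgeCM.CMField.K F))⁻¹ (fun _ _ => (repOfLine ⟨F.K⟩ (repAt a₀ (Sigma.fst i)).1 (repAt a₀ (Sigma.fst i)).2.1 (repAt a₀ (Sigma.fst i)).2.2)))).rest (restTailOne (AlgHom.id
            ℚ _) ι₁ hμ hw (Def45.Carriers.ofPolDR μ (Def45.PolDR ι₁ hμ (Def45.RMuForm ι₁ hμ))) ((heckeTranslatesFamilyOf heckeTranslate_definedOver_holds h isoOf ⟨F.K⟩ ι₁ (⟨V.Hm,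
            V.isHermitian, V.signature_ι₁, V.posDef_of_ne⟩) Φ h6).rhoΩOne (AlgHom.id ℚ _) ι₁ hμ hw (Def45.Carriers.ofPolDR μ (Def45.PolDR ι₁ hμ (Def45.RMuForm ι₁ hμ))))))).AdmIndex),
      Nontrivial ((toThm418Data _ (((uniformOmegaRep h ⟨F.K⟩ ι₁ (⟨V.Hm, V.isHermitian, V.signature_ι₁, V.posDef_of_ne⟩) Φ e₁ (frameD V) (frameD_real V) (frameD_ne V) (ιVE V) (2 *
            imagUnit (HodgeCM.CMField.K F))⁻¹ (fun _ _ => (repOfLine ⟨F.K⟩ (repAt a₀ (Sigma.fst i)).1 (repAt a₀ (Sigma.fst i)).2.1 (repAt a₀ (Sigma.fst i)).2.2)))).rest (restTailOne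
            (AlgHom.id ℚ _) ι₁ hμ hw (Def45.Carriers.ofPolDR μ (Def45.PolDR ι₁ hμ (Def45.RMuForm ι₁ hμ))) ((heckeTranslatesFamilyOf heckeTranslate_definedOver_holds h isoOf ⟨F.K⟩ ι₁
            (⟨V.Hm, V.isHermitian, V.signature_ι₁, V.posDef_of_ne⟩) Φ h6).rhoΩOne (AlgHom.id ℚ _) ι₁ hμ hw (Def45.Carriers.ofPolDR μ (Def45.PolDR ι₁ hμ (Def45.RMuForm ι₁
            hμ))))))).omegaAt j) := fun i μ hμ hw => by
    rw [← hR]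
    exact fun j => nontrivial_omegaAt_restOfCharDeltaPrime_of_lemD1AsPrinted h ⟨F.K⟩ h6 ι₁ (⟨V.Hm, V.isHermitian, V.signature_ι₁, V.posDef_of_ne⟩) Φ e₁ (frameD V) (frameD_real V)
      (frameD_ne V) (ιVE V) (repOfLine ⟨F.K⟩ (repAt a₀ (Sigma.fst i)).1 (repAt a₀ (Sigma.fst i)).2.1 (repAt a₀ (Sigma.fst i)).2.2) μ hμ hw hιs (le_refl 3) j (hD1 i μ hμ hw j)
  exact Summit.HodgeConjecture.CorCM.D2Bridge.PinSignatures.thm418C_liuDictionaryPin_of_pins V (I V (repAt a₀) (muLiu ι₁ GramClass.rep))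
    (line V (repAt a₀) (muLiu ι₁ GramClass.rep)) h Φ (sec42DataOf h isoOf ⟨F.K⟩ ι₁ (⟨V.Hm, V.isHermitian, V.signature_ι₁, V.posDef_of_ne⟩) Φ) (fun i => Continuous (i.2.1 : SplittingAt
          V (repAt a₀ i.1)))
    -- block vanishing at the NON-CONTINUOUS index lines — BY VALUE: a compatible index splitting with a central type and SMOOTH finite Weil
    -- representation is continuous (pin-3 `continuous_of_hasCentralTypeAt_of_smooth`, frame transport open), and at a non-smooth line the block
    -- vanishes (own-htheta `block_pin_lineOf_eq_bot_of_not_smooth`, [GR91 Prop. 3.1.1] discharged by `compatibleSplitting_cmSplittingDatum`)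
    (fun i _ hnc => Transposition.BlockVanishing.block_pin_lineOf_eq_bot_of_not_smooth exists_isReal_hodgeModel_holds
        hodgePQ_independent_of_hodgeModel_holds BallQuotient.ballQuotientUniformised_holds
        (cmAbelianVarietyRealised_of_eigenbasis exists_isReal_hodgeModel_holds hodgePQ_independent_of_hodgeModel_holds
          cmAbelianVarietyEigenbasisRealised_holds)
        Literature.NumberTheory.Transcendental.arapura2012_cor_15_4_6_holds V (repAt a₀) (CentralTypeIs V (muLiu ι₁ GramClass.rep)) i fun hsm =>
      hnc (Transposition.CentralTypeAtPin.continuous_of_hasCentralTypeAt_of_smooth V (repAt a₀ i.1) i.2.1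
        (isCompatAt_of_mem V (repAt a₀) (muLiu ι₁ GramClass.rep) i) (hasCentralTypeAt_of_mem V (repAt a₀) (muLiu ι₁ GramClass.rep) i) (ιVE V)
        (continuous_ιVE V) (isHomeomorph_finPart_cmKTypeHom_finAdelicToAdelic (F : Type) V.Hm (frameG V) (frameD V) (frame_congr V)).isOpenMap
        hsm.1 hsm.2))
    -- (a) U ∕ R₀ ∕ tail ∕ hLiu — BY VALUE
    (fun i _ _ => (uniformOmegaRep h ⟨F.K⟩ ι₁ (⟨V.Hm, V.isHermitian, V.signature_ι₁, V.posDef_of_ne⟩) Φ e₁ (frameD V) (frameD_real V) (frameD_ne V) (ιVE V) (2 * imagUnit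
          (HodgeCM.CMField.K F))⁻¹ (fun _ _ => (repOfLine ⟨F.K⟩ (repAt a₀ (Sigma.fst i)).1 (repAt a₀ (Sigma.fst i)).2.1 (repAt a₀ (Sigma.fst i)).2.2))))
    (fun i hi hg => ((uniformOmegaRep h ⟨F.K⟩ ι₁ (⟨V.Hm, V.isHermitian, V.signature_ι₁, V.posDef_of_ne⟩) Φ e₁ (frameD V) (frameD_real V) (frameD_ne V) (ιVE V) (2 * imagUnit
          (HodgeCM.CMField.K F))⁻¹ (fun _ _ => (repOfLine ⟨F.K⟩ (repAt a₀ (Sigma.fst i)).1 (repAt a₀ (Sigma.fst i)).2.1 (repAt a₀ (Sigma.fst i)).2.2)))).rest (restTailOne (AlgHom.id ℚ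
          _) ι₁ (hμ i hi hg) (hw i hi hg) (Def45.Carriers.ofPolDR (μ i hi hg) (Def45.PolDR ι₁ (hμ i hi hg) (Def45.RMuForm ι₁ (hμ i hi hg)))) ((heckeTranslatesFamilyOf
          heckeTranslate_definedOver_holds h isoOf ⟨F.K⟩ ι₁ (⟨V.Hm, V.isHermitian, V.signature_ι₁, V.posDef_of_ne⟩) Φ h6).rhoΩOne (AlgHom.id ℚ _) ι₁ (hμ i hi hg) (hw i hi hg)
          (Def45.Carriers.ofPolDR (μ i hi hg) (Def45.PolDR ι₁ (hμ i hi hg) (Def45.RMuForm ι₁ (hμ i hi hg)))))))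
    (fun i hi hg => (restTailOne (AlgHom.id ℚ _) ι₁ (hμ i hi hg) (hw i hi hg) (Def45.Carriers.ofPolDR (μ i hi hg) (Def45.PolDR ι₁ (hμ i hi hg) (Def45.RMuForm ι₁ (hμ i hi hg))))
          ((heckeTranslatesFamilyOf heckeTranslate_definedOver_holds h isoOf ⟨F.K⟩ ι₁ (⟨V.Hm, V.isHermitian, V.signature_ι₁, V.posDef_of_ne⟩) Φ h6).rhoΩOne (AlgHom.id ℚ _) ι₁ (hμ i hi
          hg) (hw i hi hg) (Def45.Carriers.ofPolDR (μ i hi hg) (Def45.PolDR ι₁ (hμ i hi hg) (Def45.RMuForm ι₁ (hμ i hi hg)))))))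
    (fun i hi hg => hLiu' i (μ i hi hg) (hμ i hi hg) (hw i hi hg))
    -- (b) the Ω-pin
    σ hσ e he
    -- (c) the J-record pin — BY NAME at the characters of the Ω-pin
    (fun i hi hg => M i (μ i hi hg) (hμ i hi hg) (hw i hi hg)) (fun i hi hg => jH i (μ i hi hg) (hμ i hi hg) (hw i hi hg))
    (fun i hi hg => hjHinj i (μ i hi hg) (hμ i hi hg) (hw i hi hg)) (fun i hi hg => hjH i (μ i hi hg) (hμ i hi hg) (hw i hi hg))
    -- (d) the pieces below the App-C threshold — BY NAME
    (fun _ => (HodgeCM.Level.capThree (V := V) (((sec42DataOf h isoOf ⟨F.K⟩ ι₁ (⟨V.Hm, V.isHermitian, V.signature_ι₁, V.posDef_of_ne⟩) Φ)).S.K₀.1 : Subgroup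
          ↥(HodgeCM.HermSpace3.adelicFin V)) ((sec42DataOf h isoOf ⟨F.K⟩ ι₁ (⟨V.Hm, V.isHermitian, V.signature_ι₁, V.posDef_of_ne⟩) Φ)).S.K₀.2.1)) (fun i hi hg K hK => pieces i (μ i hi
          hg) (hμ i hi hg) (hw i hi hg) K hK)
    -- [Lem D.1 (1)], [Prop 4.13], [Def 4.11], [Thm 4.18 (2)] ∕ [Lem D.1 (3)] — BY VALUE from the displayed as-printed families
    (fun i hi hg j => hnvD i (μ i hi hg) (hμ i hi hg) (hw i hi hg) j) (fun i _ _ => h413 i)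
    (fun i _ _ => ((uniformOmegaRep h ⟨F.K⟩ ι₁ (⟨V.Hm, V.isHermitian, V.signature_ι₁, V.posDef_of_ne⟩) Φ e₁ (frameD V) (frameD_real V) (frameD_ne V) (ιVE V) (2 * imagUnit
          (HodgeCM.CMField.K F))⁻¹ (fun _ _ => (repOfLine ⟨F.K⟩ (repAt a₀ (Sigma.fst i)).1 (repAt a₀ (Sigma.fst i)).2.1 (repAt a₀ (Sigma.fst
          i)).2.2)))).adjectives_rhoAt_prop413Data_of_def411AsPrinted_rest _
      (fun μ hμ hw => (restTailOne (AlgHom.id ℚ _) ι₁ hμ hw (Def45.Carriers.ofPolDR μ (Def45.PolDR ι₁ hμ (Def45.RMuForm ι₁ hμ))) ((heckeTranslatesFamilyOf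
            heckeTranslate_definedOver_holds h isoOf ⟨F.K⟩ ι₁ (⟨V.Hm, V.isHermitian, V.signature_ι₁, V.posDef_of_ne⟩) Φ h6).rhoΩOne (AlgHom.id ℚ _) ι₁ hμ hw (Def45.Carriers.ofPolDR μ
            (Def45.PolDR ι₁ hμ (Def45.RMuForm ι₁ hμ)))))) (h411' i))
    (fun i _ _ => ((uniformOmegaRep h ⟨F.K⟩ ι₁ (⟨V.Hm, V.isHermitian, V.signature_ι₁, V.posDef_of_ne⟩) Φ e₁ (frameD V) (frameD_real V) (frameD_ne V) (ιVE V) (2 * imagUnit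
          (HodgeCM.CMField.K F))⁻¹ (fun _ _ => (repOfLine ⟨F.K⟩ (repAt a₀ (Sigma.fst i)).1 (repAt a₀ (Sigma.fst i)).2.1 (repAt a₀ (Sigma.fst
          i)).2.2)))).admTriple_eq_of_areIsomorphic_of_thm418AsPrinted_rest _
      (fun μ hμ hw => (restTailOne (AlgHom.id ℚ _) ι₁ hμ hw (Def45.Carriers.ofPolDR μ (Def45.PolDR ι₁ hμ (Def45.RMuForm ι₁ hμ))) ((heckeTranslatesFamilyOf
            heckeTranslate_definedOver_holds h isoOf ⟨F.K⟩ ι₁ (⟨V.Hm, V.isHermitian, V.signature_ι₁, V.posDef_of_ne⟩) Φ h6).rhoΩOne (AlgHom.id ℚ _) ι₁ hμ hw (Def45.Carriers.ofPolDR μ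
            (Def45.PolDR ι₁ hμ (Def45.RMuForm ι₁ hμ)))))) (hLiu' i) (hμsep i))
    -- `hK`: a model level is open compact — BY VALUE
    ⟨((HodgeCM.Level.capThree (V := V) (((sec42DataOf h isoOf ⟨F.K⟩ ι₁ (⟨V.Hm, V.isHermitian, V.signature_ι₁, V.posDef_of_ne⟩) Φ)).S.K₀.1 : Subgroup ↥(HodgeCM.HermSpace3.adelicFin V))
          ((sec42DataOf h isoOf ⟨F.K⟩ ι₁ (⟨V.Hm, V.isHermitian, V.signature_ι₁, V.posDef_of_ne⟩) Φ)).S.K₀.2.1)).K, ((HodgeCM.Level.capThree (V := V) (((sec42DataOf h isoOf ⟨F.K⟩ ι₁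
          (⟨V.Hm, V.isHermitian, V.signature_ι₁, V.posDef_of_ne⟩) Φ)).S.K₀.1 : Subgroup ↥(HodgeCM.HermSpace3.adelicFin V)) ((sec42DataOf h isoOf ⟨F.K⟩ ι₁ (⟨V.Hm, V.isHermitian,
          V.signature_ι₁, V.posDef_of_ne⟩) Φ)).S.K₀.2.1)).isOpen_K, ((HodgeCM.Level.capThree (V := V) (((sec42DataOf h isoOf ⟨F.K⟩ ι₁ (⟨V.Hm, V.isHermitian, V.signature_ι₁,
          V.posDef_of_ne⟩) Φ)).S.K₀.1 : Subgroup ↥(HodgeCM.HermSpace3.adelicFin V)) ((sec42DataOf h isoOf ⟨F.K⟩ ι₁ (⟨V.Hm, V.isHermitian, V.signature_ι₁, V.posDef_of_ne⟩)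
          Φ)).S.K₀.2.1)).isCompact_K⟩

end Summit.HodgeConjecture.CorCM.D2Bridge.Thm418CAtPin

end
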